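import Summits.CriticalPhenomena.SAWScalingLimit.Theses.SAWLoopFugacityFlow
import Summits.CriticalPhenomena.SAWScalingLimit.Theses.SAWParafermion
import Literature.Probability.RandomPlanarGeometry.LoewnerDescription

/-!
# Line `capacity-clock-no-plateau` — skeleton for the crux `SimpleSubseqLimits`
(stmt-CriticalPhenomena-4982; decl
`Summit.CriticalPhenomena.SAWScalingLimit.Theses.SAWLoopFugacityFlow.SimpleSubseqLimits`, shared
verbatim by the routes SAWSteinDefect / SAWTensorRG / SAWFrontierHomotopy).

Crux-plan of the merged clock ideas (capacity-clock-no-plateau ≈ arc-range-loewner-clock ≈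
capacity-clock, triage r1-1/2/3): SHAPE from the route's avoidance values at the SET level,
ORDER from Kemppainen–Smirnov describability, glued by the deterministic ARC CLOCK lemma
(a Loewner-describable class whose range is a simple chord is simple: the half-plane capacity
clock `hcap = 2t` cannot stall, and a backtrack along an arc is a stall).

Inputs taken BY NAME as hypotheses of the composition (registered route items, not stubs):
`AvoidanceLimit` (stmt-10649, rank 2), `SLEAvoidanceValue` (stmt-10651), `AvoidancePassage`
(stmt-4984) of SAWLoopFugacityFlow, and `SAWParafermion.KSAdmissibleG1` (stmt-11346).
`SLECarrier` is not needed as a hypothesis: its content is the landed theorem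
`Negative.ae_carrier_of_isSLELaw` (Theorems/SimpleSubseqLimits/Negative/SimpleSubseqLimitsNecessary).
The endpoint/confinement clauses are carried inside the stubs (they are also the free clauses of
the landed `Negative.simpleSubseqLimits_iff_core`, Disproof §5, which a prover may import instead).

Stubs (4): `stub_rangeIsArc` (SHAPE, M–L), `stub_arcClock` (the lever, deterministic, M,
provable now), `stub_describable_of_G1` (ORDER for tame data = the SAW instance of KS 2017
Prop. 3.2 / Thms 3.9–3.10 / Thm 1.5 (ii), L), `stub_tameReduction` (the endpoint/discretisation
gap named by triage F2/F4/S2, L, partly open). Composition `SimpleSubseqLimits_of` is sorry-free.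
-/

noncomputable section

open MeasureTheory Filter Topology Set
open Literature.Probability.RandomPlanarGeometry Literature.Probability.LatticeModels
open UpperHalfPlane (upperHalfPlaneSet)
open Summit.CriticalPhenomena.SAWScalingLimit.Theses.SAWLoopFugacityFlow
  (SimpleSubseqLimits AvoidanceLimit SLEAvoidanceValue AvoidancePassage)
open Summit.CriticalPhenomena.SAWScalingLimit.Theses.SAWParafermion (KSAdmissibleG1)

namespace Summit.CriticalPhenomena.SAWScalingLimit.Cruxes.SimpleSubseqLimits.CapacityClockNoPlateau

/-! ## Vocabulary (abbreviations of the crux's own hypotheses; no new mathematics) -/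

/-- `ν` is a probability measure on curve classes that is the weak limit, along `s n → 0⁺`, of the
pushed-forward critical `δℤ²` SAW laws of `(D; a_δ, b_δ)` — the three antecedents of the crux,
verbatim. -/
def IsSubseqLimit (D : DobrushinDomain) (a b : ℝ → Site 2) (s : ℕ → ℝ)
    (ν : Measure (CurveClass ℂ)) : Prop :=
  Tendsto s atTop (𝓝[>] (0 : ℝ)) ∧ IsProbabilityMeasure ν ∧
    ∀ f : BoundedContinuousFunction (CurveClass ℂ) ℝ,
      Tendsto (fun n => ∫ γ, f γ.curve ∂(SAW.law D.carrier (s n) (a (s n)) (b (s n)))) atTop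
        (𝓝 (∫ x, f x ∂ν))

/-- The conclusion of the crux at one `(D; a, b)`: every subsequential weak limit is carried by
simple classes from `a` to `b` in `cl D` meeting `∂D` only at `a, b` (the carrier clause of
`AvoidanceDeterminesLaw`, verbatim). By Disproof §5 (landed `Negative.simpleSubseqLimits_iff_core`)
only the first and last clauses are genuine; the others are kept so that the crux is met verbatim. -/
def CarrierAt (D : DobrushinDomain) (a b : ℝ → Site 2) : Prop :=
  ∀ (s : ℕ → ℝ) (ν : Measure (CurveClass ℂ)), IsSubseqLimit D a b s ν →
    ∀ᵐ c ∂ν, c ∈ CurveClass.simple ∧ c.source = D.pt 0 ∧ c.target = D.pt 1 ∧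
      c.range ⊆ closure D.carrier ∧ c.range ∩ frontier D.carrier ⊆ {D.pt 0, D.pt 1}

/-- **Tame (admissibly discretised, boundary-rooted) data** — the regime in which the conditional
laws of the critical SAW of `Ω_δ` given any initial segment are EXACTLY members of the admissible
cell-domain family of `KSAdmissibleG1` (Kemppainen–Smirnov §4.1.6; triage F1/F4 conventions):
eventually along `δ → 0⁺`, (i) `Ω_δ = discreteDomainGraph D δ` is the subgraph of `ℤ²` INDUCED on
`meshDomain D δ` (no edge removed by the closed-segment rule), (ii) the lattice complement of
`meshDomain D δ` is connected (the polyomino is simply connected), (iii) `a δ` and `b δ` are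
BOUNDARY VERTICES (a `ℤ²`-neighbour outside `meshDomain`). Holds e.g. for every `C²` Jordan domain
with nearest-site endpoint approximations; fails for interior (mesoscopic-depth) roots and for
boundaries with sub-mesh structure at all scales (triage F2, S2). -/
def IsTame (D : DobrushinDomain) (a b : ℝ → Site 2) : Prop :=
  ∀ᶠ δ in 𝓝[>] (0 : ℝ),
    (∀ x y : Site 2, (discreteDomainGraph D.carrier δ).Adj x y ↔
        ((zdGraph 2).Adj x y ∧ x ∈ meshDomain D.carrier δ ∧ y ∈ meshDomain D.carrier δ)) ∧
    ((zdGraph 2).induce (meshDomain D.carrier δ)ᶜ).Preconnected ∧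
    (∃ w ∉ meshDomain D.carrier δ, (zdGraph 2).Adj (a δ) w) ∧
    (∃ w ∉ meshDomain D.carrier δ, (zdGraph 2).Adj (b δ) w)

/-! ## The four stubs -/

/-- **STUB 1 — SHAPE (range is the SLE_(8/3) arc), M–L.** Under the route's avoidance items, for
every subsequential weak limit `ν`, `ν`-a.e. class `c` has the RANGE of a simple chord `c'` of
`(D; a, b)` lying in `cl D` and meeting `∂D` only at `a, b`.
Plan (triage S1/F5, checked on paper by all three triagers): the SLE_(8/3) law `μ` of `D` exists
(`exists_isSLECurve_eightThirds`) and is carried by simple boundary-avoiding chords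
(`Negative.ae_carrier_of_isSLELaw`, landed); `AvoidanceLimit` + `SLEAvoidanceValue` (restriction
data of pulled-back hulls: `IsStarHull.pullbackHull`, `existsUnique_isRestrictionMap_holds`) feed
`AvoidancePassage`, so `ν(range ⊆ cl D') = μ(range ⊆ cl D')` for every hull subdomain `D'`;
FIRST the boundary clause from thin hulls over boundary segments (values → 1,
`LSWConverges.tendsto_restrictionDeriv`), THEN exhaustion `{K ∩ C = ∅} = ⋃ₙ {K ⊆ cl D'ₙ}` for
boundary-attached compacta `C` (Jordan–Schoenflies), so the Choquet/π-system data of the two-sided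
fill `M* = cl D ∖ (U_L ∪ U_R)` agree under `ν` and `μ`; `law_ν(M*) = law_μ(range)` = law of a
simple arc from `a` to `b`; a connected `range ∋ a, b` inside that arc is the arc. Uses both
endpoint limits of `IsEndpointApprox` (Disproof §2 `_false_without_tendsto_fst/snd` honoured here)
and criticality only through `AvoidanceLimit` (Disproof §9). -/
theorem stub_rangeIsArc :
    AvoidanceLimit → SLEAvoidanceValue → AvoidancePassage →
    ∀ (D : DobrushinDomain) (a b : ℝ → Site 2), SAW.IsEndpointApprox D a b →
      ∀ (s : ℕ → ℝ) (ν : Measure (CurveClass ℂ)), IsSubseqLimit D a b s ν →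
        ∀ᵐ c ∂ν, ∃ c' ∈ CurveClass.simple, c'.source = D.pt 0 ∧ c'.target = D.pt 1 ∧
          c'.range ⊆ closure D.carrier ∧ c'.range ∩ frontier D.carrier ⊆ {D.pt 0, D.pt 1} ∧
          c'.range = c.range := by
  sorry

/-- **STUB 2 — the ARC CLOCK (the lever; deterministic, M, provable now from the Loewner API).**
A curve class described by the Loewner evolution through a chordal uniformizing map `φ` of
`(D; a, b)` whose range is the range of a SIMPLE chord `c'` from `a` to `b` in `cl D` meeting `∂D`
only at `a, b` is itself simple, and runs from `a` to `b`.
Proof (triage r1-3): `c = mk c''`, `c''` the compactified `φ.boundaryExtension`-image of the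
generating curve `γ` of a chain with continuous `W` (`IsLoewnerDescribed`); `φ.bE (W 0) ∈ ∂D ∩
range = {a, b}` and `≠ b` forces `W 0 = 0`, `c'' 0 = a`; with the arc coordinate
`h = J⁻¹ ∘ c''` (`J` an injective representative of `c'`, `IsSimple.homeomorphRange`),
`γ[0, t] = φ⁻¹ (J (0, M t])  ∪ {0}` with `M` the running max of `h`, so the hull `K_t` is a
function of `M t` alone; `hcap K_t = 2t` strictly increasing (`hcap_hpFill_image_Icc_mono`,
`hcap_hpFill_image_Icc_lt_of_exit`) forces `h` strictly increasing, hence `c''` injective and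
`c ∈ CurveClass.simple` (`CurveClass.mk_mem_simple`); `c.source = φ.bE 0 = a`
(`IsChordalUniformizing`), `c.target = c'' 1 = b` (`IsCompactifiedImage`). Kemppainen–Smirnov,
arXiv:1212.6215, Thm 1.3 bullet 4 / journal Thm 1.5: "for any parametrisation the capacity is
strictly increasing". -/
theorem stub_arcClock (D : DobrushinDomain) (φ : ConformalEquiv upperHalfPlaneSet D.carrier)
    (hφ : D.IsChordalUniformizing φ) (c c' : CurveClass ℂ) (hc : IsLoewnerDescribable φ c)
    (hc' : c' ∈ CurveClass.simple) (h0 : c'.source = D.pt 0) (h1 : c'.target = D.pt 1)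
    (hcl : c'.range ⊆ closure D.carrier)
    (hfr : c'.range ∩ frontier D.carrier ⊆ {D.pt 0, D.pt 1}) (hrange : c.range = c'.range) :
    c ∈ CurveClass.simple ∧ c.source = D.pt 0 ∧ c.target = D.pt 1 := by
  sorry

/-- **STUB 3 — ORDER for tame data: Kemppainen–Smirnov describability of subsequential limits
from Condition G1 on the admissible family (L).** Under `KSAdmissibleG1` (stmt-11346: time-zero
G1, one constant, for critical SAW on simply connected polyominoes between boundary vertices), for
TAME data every subsequential weak limit is `ν`-a.e. described by the Loewner evolution through
every chordal uniformizing map `φ` of `(D; a, b)` (tree: `IsLoewnerDescribable`, the strong notion: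
`c = mk` of the compactified capacity-parametrised generating curve).
Plan: (a) exact domain Markov of `SAW.law` — given the first `k` steps the future is the critical
SAW on `{γ_k} ∪ comp_b(meshDomain ∖ {γ_0,…,γ_k})`, which under `IsTame` is an admissible
polyomino with `γ_k`, `b_δ` boundary vertices, so `KSAdmissibleG1` IS Condition G2 for this family
(KS §4.1.6); (b) KS Prop. 3.2, Thms 3.9–3.10 (the probabilistic half, to be formalised) give the
event form `IsKSRegularAlongMesh` for approximating Jordan domains `D_δ ∋ δ·a_δ ∈ ∂D_δ`
(cell domain with corner wedges at the two roots; `φ_δ → φ` by Radó/Carathéodory);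
(c) the tree's PROVED deterministic half
`ae_isLoewnerDescribable_and_tendstoInDistribution_of_regularCurves_varying` along a tail of
`s n` (laws are probability measures eventually, `Negative.eventually_isProbabilityMeasure_…`).
Criticality enters through `KSAdmissibleG1` (false for `x > x_c`, Disproof §9). -/
theorem stub_describable_of_G1 :
    KSAdmissibleG1 →
    ∀ (D : DobrushinDomain) (a b : ℝ → Site 2), SAW.IsEndpointApprox D a b → IsTame D a b →
      ∀ (s : ℕ → ℝ) (ν : Measure (CurveClass ℂ)), IsSubseqLimit D a b s ν →
        ∀ (φ : ConformalEquiv upperHalfPlaneSet D.carrier), D.IsChordalUniformizing φ →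
          ∀ᵐ c ∂ν, IsLoewnerDescribable φ c := by
  sorry

/-- **STUB 4 — TAME REDUCTION (the endpoint/discretisation gap of triage F2/F4/S2; L, partly
open).** If the conclusion of the crux holds for all TAME data, it holds for all Dobrushin
domains and all endpoint approximations.
What is known / planned: (1) DOMAIN PART, away from the marked points (M, uses `AvoidanceLimit`):
for a hull subdomain `D' ⊆ D` agreeing with `D` near `a, b`, generic for the countably many
lattices `s n · ℤ²`, the walks of `Ω_δ` with trace in `cl D'` are exactly the walks of `Ω'_δ`, so
`law_D(· ∣ range ⊆ cl D') = law_{D'}` and `‖law_D − law_{D'}‖_TV ≤ 2(1 − P_D(range ⊆ cl D'))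
→ 2(1 − Φ'_A(0)^{5/8})` (`AvoidanceLimit`), which is small for `D'` close to `D`
(`LSWConverges.tendsto_restrictionDeriv`); subsequential limits of `law_{D'}` exist along a
subsequence (domination ⇒ tightness, Prokhorov on the Polish `CurveClass ℂ`) and the carrier
clause transfers because `cl D' ⊆ cl D` and `cl D' ∩ ∂D ⊆ ∂D'`. (2) ENDPOINT PART (open): roots at mesoscopic depth
(`IsEndpointApprox` only asks `δ·a_δ → a`) and boundaries that are not lattice-tame AT `a` or `b`
— insensitivity of subsequential limits to the microscopic endpoint data (Kennedy–Lawler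
arXiv:1109.3091 lattice effects cancel in the normalised law; reversal `law(D;a,b) = rev law(D;b,a)`
handles one tame end). This is the common residue of every G-fed line on this crux. -/
theorem stub_tameReduction :
    AvoidanceLimit →
    (∀ (D : DobrushinDomain) (a b : ℝ → Site 2), SAW.IsEndpointApprox D a b → IsTame D a b →
      CarrierAt D a b) →
    ∀ (D : DobrushinDomain) (a b : ℝ → Site 2), SAW.IsEndpointApprox D a b → CarrierAt D a b := by
  sorry

/-! ## Kernel-checked glue -/

/-- SHAPE + ORDER + the arc clock give the conclusion of the crux on tame data (sorry-free modulo
the stubs it invokes). -/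
theorem carrierAt_of_isTame (hA : AvoidanceLimit) (hV : SLEAvoidanceValue) (hP : AvoidancePassage)
    (hG : KSAdmissibleG1) (D : DobrushinDomain) (a b : ℝ → Site 2)
    (hab : SAW.IsEndpointApprox D a b) (hT : IsTame D a b) : CarrierAt D a b := by
  intro s ν hsub
  obtain ⟨φ, hφ⟩ := MarkedDomain.exists_isChordalUniformizing_holds D
  filter_upwards [stub_rangeIsArc hA hV hP D a b hab s ν hsub,
    stub_describable_of_G1 hG D a b hab hT s ν hsub φ hφ] with c hc hd
  obtain ⟨c', hc's, h0, h1, hcl, hfr, hrange⟩ := hc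
  obtain ⟨hsimple, hsrc, htgt⟩ := stub_arcClock D φ hφ c c' hd hc's h0 h1 hcl hfr hrange.symm
  exact ⟨hsimple, hsrc, htgt, hrange ▸ hcl, hrange ▸ hfr⟩

/-- **COMPOSITION.** The crux `SimpleSubseqLimits` BY NAME, from the four stubs, under the route
items `AvoidanceLimit`, `SLEAvoidanceValue`, `AvoidancePassage` (SAWLoopFugacityFlow) and
`KSAdmissibleG1` (SAWParafermion) taken as named hypotheses. No `sorry` here. -/
theorem SimpleSubseqLimits_of (hA : AvoidanceLimit) (hV : SLEAvoidanceValue)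
    (hP : AvoidancePassage) (hG : KSAdmissibleG1) : SimpleSubseqLimits := by
  intro D a b hab s ν hs hν hw
  exact stub_tameReduction hA
    (fun D' a' b' hab' hT' => carrierAt_of_isTame hA hV hP hG D' a' b' hab' hT')
    D a b hab s ν ⟨hs, hν, hw⟩

end Summit.CriticalPhenomena.SAWScalingLimit.Cruxes.SimpleSubseqLimits.CapacityClockNoPlateau

end
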